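import Summits.RiemannHypothesis.RiemannHypothesis.Theorems.ThetaTier2Cells
import HarnessLib

/-!
# THETA tier-2 kernel checker — soundness of ONE depth cell `cellStep` (cc-s2-1, WEIL typing lane; RH-FREE)

(K1) per cell (HOME/cc-s2-1/gen22/TIER2-KERNEL-SPEC.md §2/§6(a)).  The loop state `st : St` at cell `j` ENCLOSES the real trackers
(`CellInv`): `val st.lo ≤ θ₀e^{jτ} ≤ val st.hi`, `e^{−(m+½)jτ} ≤ val st.emh`, `e^{−mjτ} ≤ val st.em`, `e^{−(m−1)jτ} ≤ val st.em1`,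
`e^{−jτ/2} ≤ val st.eh`.  `cellStep_inv` propagates the enclosure to cell `j+1` (iterated `mulD/mulU` by the `e^{±τ}` / `e^{−cτ}` atoms), and
`cellStep_envelope` bounds, for every `t` in the closed cell `[jτ, (j+1)τ]`, the E2/E3 envelopes

  `e(t)  = e^{−(m+½)t}·S(t)·c̄_j ≤ val e_j`,
  `e′(t) = e^{−t/2}·[(½M₀e^{−mt}S(t) + M₁₀e^{−(m−1)t}S₁(t))·c̄_j + M₀e^{−mt}S(t)·c̄′_j] ≤ val e′_j`,   `S(t) ≤ val S_j`,

where `e_j, e′_j, S_j` are the heads of the three lists pushed by `cellStep A j st`, `c̄_j = val (cut value)`, `c̄′_j = val (cut-derivative value)`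
(their meaning as Irwin–Hall values is a data fact), and `M₀ ≤ val A.M0`, `M₁₀ ≤ val A.M10`, `R ≤ val A.residm1`, `Rm ≤ val A.residm` are any reals
enclosed by the atoms.  Nothing here bears on the truth of RH.
-/

set_option linter.dupNamespace false  -- the mandated namespace repeats `RiemannHypothesis`
set_option autoImplicit false

namespace Summit.RiemannHypothesis.RiemannHypothesis.Theorems.ThetaTier2

open Real Finset

/-- The real data the atoms of `A` must enclose for the cell stage. [this cell, TIER2-KERNEL-SPEC §1] -/
structure CellAtoms (A : Inp) (θ₀ τ M₀ M₁₀ c₂ ε R Rm : ℝ) : Prop where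
  τ_pos : 0 < τ
  θ₀_pos : 0 < θ₀
  etL : val A.etL ≤ exp τ
  etH : exp τ ≤ val A.etH
  emhStep : exp (-(A.m + 1 / 2 : ℝ) * τ) ≤ val A.emhStep
  emStep : exp (-(A.m : ℝ) * τ) ≤ val A.emStep
  em1Step : exp (-(A.m - 1 : ℝ) * τ) ≤ val A.em1Step
  ehStep : exp (-(1 / 2 : ℝ) * τ) ≤ val A.ehStep
  M₀_nonneg : 0 ≤ M₀
  M₀_le : M₀ ≤ val A.M0
  M₁₀_nonneg : 0 ≤ M₁₀
  M₁₀_le : M₁₀ ≤ val A.M10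
  c₂_nonneg : 0 ≤ c₂
  c₂_le : c₂ ≤ val A.c2
  ε_nonneg : 0 ≤ ε
  ε_le : ε ≤ val A.eps
  R_nonneg : 0 ≤ R
  R_le : R ≤ val A.residm1
  Rm_nonneg : 0 ≤ Rm
  Rm_le : Rm ≤ val A.residm
  pi_mem : val A.piL ≤ π ∧ π ≤ val A.piH
  pi_width : val A.piH - val A.piL ≤ 1 / 2 ^ 30
  m_pos : 1 ≤ A.m

/-- The loop invariant at cell `j`: the state encloses `θ₀e^{jτ}` and the four exponentials. [this cell] -/
structure CellInv (A : Inp) (θ₀ τ : ℝ) (j : ℕ) (st : St) : Prop where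
  lo_le : val st.lo ≤ θ₀ * exp (j * τ)
  le_hi : θ₀ * exp (j * τ) ≤ val st.hi
  lo_pos : 0 < st.lo
  emh : exp (-(A.m + 1 / 2 : ℝ) * (j * τ)) ≤ val st.emh
  em : exp (-(A.m : ℝ) * (j * τ)) ≤ val st.em
  em1 : exp (-(A.m - 1 : ℝ) * (j * τ)) ≤ val st.em1
  eh : exp (-(1 / 2 : ℝ) * (j * τ)) ≤ val st.eh

/-- `e^{−c(j+1)τ} = e^{−cjτ}·e^{−cτ}`. [folklore] -/
theorem exp_neg_mul_succ (c τ : ℝ) (j : ℕ) :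
    exp (-c * (((j + 1 : ℕ) : ℝ) * τ)) = exp (-c * (j * τ)) * exp (-c * τ) := by
  rw [← exp_add]; push_cast; ring_nf

/-- **Invariant propagation**: `CellInv` at `j` ⇒ `CellInv` at `j+1` for `cellStep A j st` (the new `lo` must stay positive: a decidable
data fact supplied as `hlo'`). [this cell, TIER2-KERNEL-SPEC §2 (E3)] -/
theorem cellStep_inv (A : Inp) {θ₀ τ M₀ M₁₀ c₂ ε R Rm : ℝ} (hA : CellAtoms A θ₀ τ M₀ M₁₀ c₂ ε R Rm)
    {j : ℕ} {st : St} (h : CellInv A θ₀ τ j st) (hlo' : 0 < mulD st.lo A.etL) :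
    CellInv A θ₀ τ (j + 1) (cellStep A j st) := by
  have hθ := hA.θ₀_pos
  have hstep : θ₀ * exp (((j + 1 : ℕ) : ℝ) * τ) = θ₀ * exp (j * τ) * exp τ := by
    rw [mul_assoc, ← exp_add]; push_cast; ring_nf
  unfold cellStep
  dsimp only
  obtain ⟨p, hx⟩ : ∃ p, harm A st.lo (mulU st.hi A.etH) (divU S st.lo) A.K 0 0 = p := ⟨_, rfl⟩
  rcases p with ⟨sSum, s1Sum⟩
  rw [hx]
  dsimp only
  refine ⟨?_, ?_, hlo', ?_, ?_, ?_, ?_⟩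
  · rw [hstep]
    exact mulD_le h.lo_le hA.etL
  · rw [hstep]
    exact le_mulU (exp_pos τ).le h.le_hi hA.etH
  · rw [exp_neg_mul_succ]; exact le_mulU (exp_pos _).le h.emh hA.emhStep
  · rw [exp_neg_mul_succ]; exact le_mulU (exp_pos _).le h.em hA.emStep
  · rw [exp_neg_mul_succ]; exact le_mulU (exp_pos _).le h.em1 hA.em1Step
  · rw [exp_neg_mul_succ]; exact le_mulU (exp_pos _).le h.eh hA.ehStep

/-- The three values pushed by `cellStep` (as explicit expressions in the `harm` accumulators). [this cell] -/
theorem cellStep_heads (A : Inp) (j : ℕ) (st : St) :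
    (cellStep A j st).sRev = ((harm A st.lo (mulU st.hi A.etH) (divU S st.lo) A.K 0 0).1 + A.residm1) :: st.sRev ∧
    (cellStep A j st).eRev = mulU (mulU st.emh ((harm A st.lo (mulU st.hi A.etH) (divU S st.lo) A.K 0 0).1 + A.residm1))
        (if j < A.ncut then A.cList.getD j S else S) :: st.eRev ∧
    (cellStep A j st).epRev = mulU st.eh
        (mulU (divUn (mulU (mulU A.M0 st.em) ((harm A st.lo (mulU st.hi A.etH) (divU S st.lo) A.K 0 0).1 + A.residm1)) 2
            + mulU (mulU A.M10 st.em1) ((harm A st.lo (mulU st.hi A.etH) (divU S st.lo) A.K 0 0).2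
              + mulU A.residm (A.c2 + mulU A.eps (S + divUn (divU S st.lo) (A.K + 1))))) (if j < A.ncut then A.cList.getD j S else S)
          + mulU (mulU (mulU A.M0 st.em) ((harm A st.lo (mulU st.hi A.etH) (divU S st.lo) A.K 0 0).1 + A.residm1))
            (if j < A.ncut then A.cpList.getD j 0 else 0)) :: st.epRev := by
  unfold cellStep
  dsimp only
  obtain ⟨p, hx⟩ : ∃ p, harm A st.lo (mulU st.hi A.etH) (divU S st.lo) A.K 0 0 = p := ⟨_, rfl⟩
  rcases p with ⟨sSum, s1Sum⟩
  rw [hx]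
  exact ⟨rfl, rfl, rfl⟩

/-- **`S(t) ≤ val S_j`** for the value pushed by `cellStep` (head of `sRev`), `t` in the closed cell. [this cell, TIER2-KERNEL-SPEC §2 (E1)] -/
theorem cellStep_S (A : Inp) {θ₀ τ M₀ M₁₀ c₂ ε R Rm : ℝ} (hA : CellAtoms A θ₀ τ M₀ M₁₀ c₂ ε R Rm)
    {j : ℕ} {st : St} (h : CellInv A θ₀ τ j st) (hsz : (A.K : ℝ) * val (mulU st.hi A.etH) ≤ 2 ^ 24)
    {t : ℝ} (ht1 : (j : ℝ) * τ ≤ t) (ht2 : t ≤ ((j : ℝ) + 1) * τ) :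
    Sfun θ₀ R A.m A.K t ≤ val ((cellStep A j st).sRev.headD 0) := by
  have hθ := hA.θ₀_pos
  -- the base angle on the cell
  have hbt : val st.lo ≤ θ₀ * exp t ∧ θ₀ * exp t ≤ val (mulU st.hi A.etH) := by
    obtain ⟨b1, b2⟩ := base_angle_mem hθ.le ht1 ht2
    refine ⟨h.lo_le.trans b1, b2.trans ?_⟩
    have : θ₀ * exp (((j : ℝ) + 1) * τ) = θ₀ * exp (j * τ) * exp τ := by rw [mul_assoc, ← exp_add]; ring_nf
    rw [this]; exact le_mulU (exp_pos τ).le h.le_hi hA.etH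
  have hpos : 0 < θ₀ * exp t := mul_pos hθ (exp_pos t)
  have hinv : (θ₀ * exp t)⁻¹ ≤ val (divU S st.lo) := by
    have h1 : (θ₀ * exp t)⁻¹ ≤ (val st.lo)⁻¹ := by
      have hlo0 : 0 < val st.lo := by have := val_lt_val.2 h.lo_pos; rwa [val_zero] at this
      exact (inv_le_inv₀ hpos hlo0).2 hbt.1
    refine h1.trans ?_
    rw [inv_eq_one_div, ← val_S]
    exact le_divU (le_refl _) h.lo_pos le_rfl
  have hS : Sfun θ₀ R A.m A.K t ≤ val ((harm A st.lo (mulU st.hi A.etH) (divU S st.lo) A.K 0 0).1 + A.residm1) :=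
    Sfun_le_cell A hA.pi_mem hA.pi_width hA.m_pos hsz hbt.1 hbt.2 hA.R_le
  have hS0 : 0 ≤ Sfun θ₀ R A.m A.K t := by
    unfold Sfun
    exact add_nonneg (sum_nonneg fun k _ => by positivity) hA.R_nonneg
  have hm0 : (0 : ℝ) ≤ A.m := Nat.cast_nonneg _
  have hm1 : (0 : ℝ) ≤ (A.m : ℝ) - 1 := by have := hA.m_pos; rw [sub_nonneg]; exact_mod_cast this
  have hemh : exp (-(A.m + 1 / 2 : ℝ) * t) ≤ val st.emh := (exp_neg_mul_le_of_le (by linarith) ht1).trans h.emh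
  have hem : exp (-(A.m : ℝ) * t) ≤ val st.em := (exp_neg_mul_le_of_le hm0 ht1).trans h.em
  have hem1 : exp (-(A.m - 1 : ℝ) * t) ≤ val st.em1 := (exp_neg_mul_le_of_le hm1 ht1).trans h.em1
  have heh : exp (-(1 / 2 : ℝ) * t) ≤ val st.eh := (exp_neg_mul_le_of_le (by norm_num) ht1).trans h.eh
  unfold cellStep
  dsimp only
  obtain ⟨p, hx⟩ : ∃ p, harm A st.lo (mulU st.hi A.etH) (divU S st.lo) A.K 0 0 = p := ⟨_, rfl⟩
  rcases p with ⟨sSum, s1Sum⟩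
  rw [hx] at hS ⊢
  exact hS

/-- **`e(t) = e^{−(m+½)t}·S(t)·c̄_j ≤ val e_j`** (head of `eRev`) for `0 ≤ c̄_j ≤ val c_j`. [this cell, TIER2-KERNEL-SPEC §2 (E3)] -/
theorem cellStep_e (A : Inp) {θ₀ τ M₀ M₁₀ c₂ ε R Rm : ℝ} (hA : CellAtoms A θ₀ τ M₀ M₁₀ c₂ ε R Rm)
    {j : ℕ} {st : St} (h : CellInv A θ₀ τ j st) (hsz : (A.K : ℝ) * val (mulU st.hi A.etH) ≤ 2 ^ 24)
    {cb : ℝ} (hcb0 : 0 ≤ cb) (hcb : cb ≤ val (if j < A.ncut then A.cList.getD j S else S))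
    {t : ℝ} (ht1 : (j : ℝ) * τ ≤ t) (ht2 : t ≤ ((j : ℝ) + 1) * τ) :
    exp (-(A.m + 1 / 2 : ℝ) * t) * Sfun θ₀ R A.m A.K t * cb ≤ val ((cellStep A j st).eRev.headD 0) := by
  have hθ := hA.θ₀_pos
  -- the base angle on the cell
  have hbt : val st.lo ≤ θ₀ * exp t ∧ θ₀ * exp t ≤ val (mulU st.hi A.etH) := by
    obtain ⟨b1, b2⟩ := base_angle_mem hθ.le ht1 ht2
    refine ⟨h.lo_le.trans b1, b2.trans ?_⟩
    have : θ₀ * exp (((j : ℝ) + 1) * τ) = θ₀ * exp (j * τ) * exp τ := by rw [mul_assoc, ← exp_add]; ring_nf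
    rw [this]; exact le_mulU (exp_pos τ).le h.le_hi hA.etH
  have hpos : 0 < θ₀ * exp t := mul_pos hθ (exp_pos t)
  have hinv : (θ₀ * exp t)⁻¹ ≤ val (divU S st.lo) := by
    have h1 : (θ₀ * exp t)⁻¹ ≤ (val st.lo)⁻¹ := by
      have hlo0 : 0 < val st.lo := by have := val_lt_val.2 h.lo_pos; rwa [val_zero] at this
      exact (inv_le_inv₀ hpos hlo0).2 hbt.1
    refine h1.trans ?_
    rw [inv_eq_one_div, ← val_S]
    exact le_divU (le_refl _) h.lo_pos le_rfl
  have hS : Sfun θ₀ R A.m A.K t ≤ val ((harm A st.lo (mulU st.hi A.etH) (divU S st.lo) A.K 0 0).1 + A.residm1) :=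
    Sfun_le_cell A hA.pi_mem hA.pi_width hA.m_pos hsz hbt.1 hbt.2 hA.R_le
  have hS0 : 0 ≤ Sfun θ₀ R A.m A.K t := by
    unfold Sfun
    exact add_nonneg (sum_nonneg fun k _ => by positivity) hA.R_nonneg
  have hm0 : (0 : ℝ) ≤ A.m := Nat.cast_nonneg _
  have hm1 : (0 : ℝ) ≤ (A.m : ℝ) - 1 := by have := hA.m_pos; rw [sub_nonneg]; exact_mod_cast this
  have hemh : exp (-(A.m + 1 / 2 : ℝ) * t) ≤ val st.emh := (exp_neg_mul_le_of_le (by linarith) ht1).trans h.emh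
  have hem : exp (-(A.m : ℝ) * t) ≤ val st.em := (exp_neg_mul_le_of_le hm0 ht1).trans h.em
  have hem1 : exp (-(A.m - 1 : ℝ) * t) ≤ val st.em1 := (exp_neg_mul_le_of_le hm1 ht1).trans h.em1
  have heh : exp (-(1 / 2 : ℝ) * t) ≤ val st.eh := (exp_neg_mul_le_of_le (by norm_num) ht1).trans h.eh
  rw [(cellStep_heads A j st).2.1, List.headD_cons]
  exact envelope_le_mulU hemh hS0 hS hcb0 hcb

/-- **`e′(t) ≤ val e′_j`** (head of `epRev`): `e′(t) = e^{−t/2}·[(½M₀e^{−mt}S + M₁₀e^{−(m−1)t}S₁)·c̄_j + M₀e^{−mt}S·c̄′_j]`.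
[this cell, TIER2-KERNEL-SPEC §2 (E3)] -/
theorem cellStep_ep (A : Inp) {θ₀ τ M₀ M₁₀ c₂ ε R Rm : ℝ} (hA : CellAtoms A θ₀ τ M₀ M₁₀ c₂ ε R Rm)
    {j : ℕ} {st : St} (h : CellInv A θ₀ τ j st) (hsz : (A.K : ℝ) * val (mulU st.hi A.etH) ≤ 2 ^ 24)
    {cb cpb : ℝ} (hcb0 : 0 ≤ cb) (hcb : cb ≤ val (if j < A.ncut then A.cList.getD j S else S))
    (hcpb0 : 0 ≤ cpb) (hcpb : cpb ≤ val (if j < A.ncut then A.cpList.getD j 0 else 0))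
    {t : ℝ} (ht1 : (j : ℝ) * τ ≤ t) (ht2 : t ≤ ((j : ℝ) + 1) * τ) :
    exp (-(1 / 2 : ℝ) * t) * ((M₀ / 2 * exp (-(A.m : ℝ) * t) * Sfun θ₀ R A.m A.K t
        + M₁₀ * exp (-(A.m - 1 : ℝ) * t) * S1fun θ₀ c₂ ε Rm A.m A.K t) * cb
        + M₀ * exp (-(A.m : ℝ) * t) * Sfun θ₀ R A.m A.K t * cpb) ≤ val ((cellStep A j st).epRev.headD 0) := by
  have hθ := hA.θ₀_pos
  -- the base angle on the cell
  have hbt : val st.lo ≤ θ₀ * exp t ∧ θ₀ * exp t ≤ val (mulU st.hi A.etH) := by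
    obtain ⟨b1, b2⟩ := base_angle_mem hθ.le ht1 ht2
    refine ⟨h.lo_le.trans b1, b2.trans ?_⟩
    have : θ₀ * exp (((j : ℝ) + 1) * τ) = θ₀ * exp (j * τ) * exp τ := by rw [mul_assoc, ← exp_add]; ring_nf
    rw [this]; exact le_mulU (exp_pos τ).le h.le_hi hA.etH
  have hpos : 0 < θ₀ * exp t := mul_pos hθ (exp_pos t)
  have hinv : (θ₀ * exp t)⁻¹ ≤ val (divU S st.lo) := by
    have h1 : (θ₀ * exp t)⁻¹ ≤ (val st.lo)⁻¹ := by
      have hlo0 : 0 < val st.lo := by have := val_lt_val.2 h.lo_pos; rwa [val_zero] at this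
      exact (inv_le_inv₀ hpos hlo0).2 hbt.1
    refine h1.trans ?_
    rw [inv_eq_one_div, ← val_S]
    exact le_divU (le_refl _) h.lo_pos le_rfl
  have hS : Sfun θ₀ R A.m A.K t ≤ val ((harm A st.lo (mulU st.hi A.etH) (divU S st.lo) A.K 0 0).1 + A.residm1) :=
    Sfun_le_cell A hA.pi_mem hA.pi_width hA.m_pos hsz hbt.1 hbt.2 hA.R_le
  have hS0 : 0 ≤ Sfun θ₀ R A.m A.K t := by
    unfold Sfun
    exact add_nonneg (sum_nonneg fun k _ => by positivity) hA.R_nonneg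
  have hm0 : (0 : ℝ) ≤ A.m := Nat.cast_nonneg _
  have hm1 : (0 : ℝ) ≤ (A.m : ℝ) - 1 := by have := hA.m_pos; rw [sub_nonneg]; exact_mod_cast this
  have hemh : exp (-(A.m + 1 / 2 : ℝ) * t) ≤ val st.emh := (exp_neg_mul_le_of_le (by linarith) ht1).trans h.emh
  have hem : exp (-(A.m : ℝ) * t) ≤ val st.em := (exp_neg_mul_le_of_le hm0 ht1).trans h.em
  have hem1 : exp (-(A.m - 1 : ℝ) * t) ≤ val st.em1 := (exp_neg_mul_le_of_le hm1 ht1).trans h.em1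
  have heh : exp (-(1 / 2 : ℝ) * t) ≤ val st.eh := (exp_neg_mul_le_of_le (by norm_num) ht1).trans h.eh
  have hS1 : S1fun θ₀ c₂ ε Rm A.m A.K t ≤ val ((harm A st.lo (mulU st.hi A.etH) (divU S st.lo) A.K 0 0).2
      + mulU A.residm (A.c2 + mulU A.eps (S + divUn (divU S st.lo) (A.K + 1)))) :=
    S1fun_le_cell A hA.pi_mem hA.pi_width hA.m_pos hsz hbt.1 hbt.2 hpos hA.c₂_nonneg hA.c₂_le hA.ε_nonneg hA.ε_le hinv hA.Rm_le
  have hS10 : 0 ≤ S1fun θ₀ c₂ ε Rm A.m A.K t := by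
    unfold S1fun
    have hι0 : 0 ≤ (θ₀ * exp t)⁻¹ := inv_nonneg.2 hpos.le
    have := hA.c₂_nonneg; have := hA.ε_nonneg; have := hA.Rm_nonneg
    exact add_nonneg (sum_nonneg fun k _ => by positivity) (by positivity)
  rw [(cellStep_heads A j st).2.2, List.headD_cons]
  set sSum := (harm A st.lo (mulU st.hi A.etH) (divU S st.lo) A.K 0 0).1 with hsSum
  set s1Sum := (harm A st.lo (mulU st.hi A.etH) (divU S st.lo) A.K 0 0).2 with hs1Sum
  have hM0S : M₀ * exp (-(A.m : ℝ) * t) * Sfun θ₀ R A.m A.K t ≤ val (mulU (mulU A.M0 st.em) (sSum + A.residm1)) :=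
    le_mulU hS0 (le_mulU (exp_pos _).le hA.M₀_le hem) hS
  have hhalf : M₀ / 2 * exp (-(A.m : ℝ) * t) * Sfun θ₀ R A.m A.K t ≤ val (divUn (mulU (mulU A.M0 st.em) (sSum + A.residm1)) 2) := by
    have := le_divUn hM0S (show 0 < 2 by norm_num)
    push_cast at this
    linarith
  have hM10S : M₁₀ * exp (-(A.m - 1 : ℝ) * t) * S1fun θ₀ c₂ ε Rm A.m A.K t ≤
      val (mulU (mulU A.M10 st.em1) (s1Sum + mulU A.residm (A.c2 + mulU A.eps (S + divUn (divU S st.lo) (A.K + 1))))) :=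
    le_mulU hS10 (le_mulU (exp_pos _).le hA.M₁₀_le hem1) hS1
  have hsum : (M₀ / 2 * exp (-(A.m : ℝ) * t) * Sfun θ₀ R A.m A.K t
        + M₁₀ * exp (-(A.m - 1 : ℝ) * t) * S1fun θ₀ c₂ ε Rm A.m A.K t) * cb ≤
      val (mulU (divUn (mulU (mulU A.M0 st.em) (sSum + A.residm1)) 2
        + mulU (mulU A.M10 st.em1) (s1Sum + mulU A.residm (A.c2 + mulU A.eps (S + divUn (divU S st.lo) (A.K + 1)))))
        (if j < A.ncut then A.cList.getD j S else S)) :=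
    le_mulU hcb0 (by rw [val_add]; linarith) hcb
  have hlast : M₀ * exp (-(A.m : ℝ) * t) * Sfun θ₀ R A.m A.K t * cpb ≤
      val (mulU (mulU (mulU A.M0 st.em) (sSum + A.residm1)) (if j < A.ncut then A.cpList.getD j 0 else 0)) :=
    le_mulU hcpb0 hM0S hcpb
  have hinner := add_le_add hsum hlast
  rw [← val_add] at hinner
  have h01 := hA.M₀_nonneg
  have h02 := hA.M₁₀_nonneg
  have hin0 : 0 ≤ (M₀ / 2 * exp (-(A.m : ℝ) * t) * Sfun θ₀ R A.m A.K t
        + M₁₀ * exp (-(A.m - 1 : ℝ) * t) * S1fun θ₀ c₂ ε Rm A.m A.K t) * cb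
        + M₀ * exp (-(A.m : ℝ) * t) * Sfun θ₀ R A.m A.K t * cpb := by positivity
  exact le_mulU hin0 heh hinner

end Summit.RiemannHypothesis.RiemannHypothesis.Theorems.ThetaTier2
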